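import Summits.QuantumFields.YangMills.Theorems.BalabanUVNodesN14LawChannelPushForwardRoad

/-!
# BalabanUVNodes ∕ N14 — THE PUSH-FORWARD JUNCTION INHABITED: a FIBRE-ONLY defect of ANY size is INVISIBLE on the class space (decided toy;
# referee A1∕A2: the hypotheses of `tvSandwich_of_finePath` are jointly satisfiable with every datum PRODUCED, and the conclusion is sharp)

Cell `pub-ymgap` (HUMAN RULING D-0062, Track A), node N14 = NE1′, seat `pub-ymgap-dag-n14-c` (R134 ACCELERATION, s1), generation 8; cluster
K3⁶ `SpineGivenEndpointR13SepCoPR` (stmt-QuantumFields-20509; `--kind proof --supports … --as helper`, dag-lead WORDS-142).  ADDITIVE — imports the junction module `Thm/BalabanUVNodesN14LawChannelPushForwardRoad`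
(hence `…PushForwardPath`, the dictionary `…PushForward`, dag-n19-c's road III) ONLY; 0 `def`; edits nothing.  COUNT-NEUTRAL.  Fourth (last) module of INTENT-36.

THE TOY (the PRODUCT CARICATURE of lens-control F2 vs (F2′), file P p499366 §4, now THROUGH THE JUNCTION).  Fine space `α × γ` (standard Borel), class
map `q = Prod.fst`, fine law `μ ⊗ π` (`μ` finite = the class field's law, `π` a probability law of the INDEPENDENT fibre), two runs differing by a
FIBRE-ONLY log-density `φ ∘ Prod.snd` (`φ` bounded measurable, otherwise ARBITRARY — its raw oscillation `∫ |φ − ∫φ| dπ` may be as large as one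
likes), joined by the straight path `Ψ_u = u·(φ ∘ snd)`.
* §1 the disintegration of a product law along `fst` IS the product fibre: `jointLaw_prod_fst` (`jointLaw (μ ⊗ π) fst = μ ⊗ₘ (δ ⊗ₖ π)`),
  ★ `condLaw_prod_fst_ae` (`condLaw (μ ⊗ π) fst a = δ_a ⊗ π` for `μ`-a.e. `a`, Mathlib `eq_condKernel_of_measure_eq_compProd`), `integral_dirac_prod_comp_snd`.
* §2 the class-space letters of the toy: `condDirection_prod_ae` (the CONDITIONED direction `h_u ∘ fst` is the CONSTANT `c_u = ∫ φ d(π.tilted (u·φ))` a.e.),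
  `integral_dir_prod_tilted` (the fine drift is the same constant), ★ `condOsc_prod_eq_zero` (the CONDITIONED oscillation VANISHES at every `u`).
* §3 ★★ `tvSandwich_toy` — `tvSandwich_of_finePath` INSTANTIATED with every hypothesis discharged from the toy's data (`ι = Unit`, one good class, no
  bad class, `ρ ≡ 0`): the normalised image laws of the two runs AGREE on every measurable class-space set although the two FINE laws differ by an
  arbitrary bounded tilt — the junction's OSC letter is the conditioned one ((F2′)); read upstairs (raw oscillation `∫ |φ∘snd − c_u| dν̂_u`) road III's
  letter would be as large as `φ` is rough.  ★★ `core_toy` — `core_of_finePath` INSTANTIATED likewise (class-free drift `k(u) = log ∫ e^{u·φ} dπ`, `r₁ ≡ 0`,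
  `ρ ≡ 0`): `Spine.NE7.Core … 0` with width ZERO for every bounded class observable.  ★ `map_tilted_fibreDefect_eq` — the same sentence without the family
  apparatus.
HONEST FRAMING.  A decided toy on [folklore] measure theory; it inhabits the junction's hypotheses non-degenerately and nothing more; nothing of Bałaban's;
N14 ∕ N19 NOT discharged; counts UNMOVED (typed 28∕28 · discharged 5∕27 · A 5∕28); one finite four-torus at fixed `ε` — NOT ℝ⁴, NOT OS, NOT a mass
gap, NOT Clay.  0 `def`; 0 `sorry`; standard axioms.
-/

set_option autoImplicit false

noncomputable section

open MeasureTheory ProbabilityTheory Set Filter Topology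
open scoped ENNReal NNReal

namespace YMDAG.N14.LawChannelPushForwardToy

open Literature.MathematicalPhysics.QuantumFieldTheory.Balaban1983to89.T4AveragingDisintegration
open Summit.QuantumFields.YangMills.BalabanUVNodes.N19TiltPathCalculus (integrable_of_abs_le integral_tilted_eq_div
  hasDerivAt_log_integral_exp_tiltPath)
open Literature.MathematicalPhysics.QuantumFieldTheory.Balaban1983to89.T4VarianceMatching.Tilt (integrable_exp_of_abs_le)
open YMDAG.N14.LawChannelPushForward
open YMDAG.N14.LawChannelPushForwardRoad (tvSandwich_of_finePath core_of_finePath)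
open Summit.QuantumFields.BalabanUV.T4Continuum.NE1p.DressedMGFForm (MGFForm)
open Summit.QuantumFields.BalabanUV.T4Continuum (Spine.NE7.Core)

variable {α γ : Type*} [MeasurableSpace α] [MeasurableSpace γ]

/-! ## §1 The disintegration of a product law along the first projection is the product fibre -/

/-- The joint law of `(fst, id)` under a product measure is the composition-product of the first factor with the kernel `a ↦ δ_a ⊗ π`. [folklore] -/
theorem jointLaw_prod_fst (μ : Measure α) [SFinite μ] (π : Measure γ) [IsProbabilityMeasure π] :
    jointLaw (μ.prod π) Prod.fst = μ ⊗ₘ ((Kernel.deterministic id measurable_id) ×ₖ (Kernel.const α π)) := by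
  ext s hs
  rw [jointLaw, Measure.map_apply (measurable_graphMap measurable_fst) hs, Measure.compProd_apply hs,
    Measure.prod_apply ((measurable_graphMap measurable_fst) hs)]
  refine lintegral_congr fun a => ?_
  rw [Kernel.prod_apply' _ _ _ (measurable_prodMk_left hs)]
  simp only [Kernel.deterministic_apply, Kernel.const_apply, id]
  rw [lintegral_dirac' _ (measurable_measure_prodMk_left (measurable_prodMk_left hs))]
  rfl

/-- ★ **THE CONDITIONAL KERNEL OF A PRODUCT LAW**: `condLaw (μ ⊗ π) fst a = δ_a ⊗ π` for `μ`-almost every `a` (disintegration uniqueness, Mathlib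
`eq_condKernel_of_measure_eq_compProd`). [folklore] -/
theorem condLaw_prod_fst_ae [StandardBorelSpace α] [StandardBorelSpace γ] [Nonempty α] [Nonempty γ]
    (μ : Measure α) [IsFiniteMeasure μ] (π : Measure γ) [IsProbabilityMeasure π] :
    ∀ᵐ a ∂μ, condLaw (μ.prod π) Prod.fst a = (Measure.dirac a).prod π := by
  have hfst : (jointLaw (μ.prod π) Prod.fst).fst = μ := by
    rw [jointLaw_fst _ measurable_fst, Measure.map_fst_prod]; simp
  have key := eq_condKernel_of_measure_eq_compProd
    ((Kernel.deterministic id measurable_id) ×ₖ (Kernel.const α π)) (ρ := jointLaw (μ.prod π) Prod.fst)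
    (by rw [hfst]; exact jointLaw_prod_fst μ π)
  rw [hfst] at key
  filter_upwards [key] with a ha
  rw [condLaw, ← ha, Kernel.prod_apply, Kernel.deterministic_apply, Kernel.const_apply]
  rfl

/-- On the fibre law `δ_a ⊗ π`, a measurable function of the fibre coordinate integrates to its `π`-integral. [folklore] -/
theorem integral_dirac_prod_comp_snd (a : α) (π : Measure γ) [SFinite π] {f : γ → ℝ} (hf : Measurable f) :
    ∫ z, f z.2 ∂((Measure.dirac a).prod π) = ∫ c, f c ∂π := by
  have hae : AEStronglyMeasurable (fun z : α × γ => f z.2) (Measure.map (Prod.mk a) π) :=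
    (hf.comp measurable_snd).aestronglyMeasurable
  rw [Measure.dirac_prod, integral_map measurable_prodMk_left.aemeasurable hae]

/-! ## §2 The toy's class-space letters: constant conditioned direction, vanishing conditioned oscillation -/

section Letters

variable [StandardBorelSpace α] [StandardBorelSpace γ] [Nonempty α] [Nonempty γ]
  (μ : Measure α) [IsFiniteMeasure μ] (π : Measure γ) [IsProbabilityMeasure π] {φ : γ → ℝ} {B : ℝ}

/-- **THE CONDITIONED DIRECTION IS A CONSTANT**: for `μ`-a.e. class point `a`, the fibre-tilted mean of `φ ∘ snd` along the straight path
`u·(φ ∘ snd)` is `c_u = ∫ φ d(π.tilted (u·φ))` — it does not see `a`. [folklore] -/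
theorem condDirection_prod_ae (hφm : Measurable φ) (u : ℝ) :
    ∀ᵐ a ∂μ, ∫ z, φ z.2 ∂((condLaw (μ.prod π) Prod.fst a).tilted fun z => u * φ z.2) = ∫ c, φ c ∂(π.tilted fun c => u * φ c) := by
  filter_upwards [condLaw_prod_fst_ae μ π] with a ha
  rw [ha, integral_tilted_eq_div, integral_tilted_eq_div,
    integral_dirac_prod_comp_snd a π (f := fun c => φ c * Real.exp (u * φ c)) (hφm.mul (Real.measurable_exp.comp (measurable_const.mul hφm))),
    integral_dirac_prod_comp_snd a π (f := fun c => Real.exp (u * φ c)) (Real.measurable_exp.comp (measurable_const.mul hφm))]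

omit [StandardBorelSpace α] [StandardBorelSpace γ] [Nonempty α] [Nonempty γ] in
/-- **THE FINE DRIFT IS THE SAME CONSTANT**: `∫ φ∘snd d((μ ⊗ π).tilted (u·(φ∘snd))) = ∫ φ d(π.tilted (u·φ))` for `μ ≠ 0` (the class factor
integrates out — Fubini `integral_prod_mul`). [folklore] -/
theorem integral_dir_prod_tilted [NeZero μ] (u : ℝ) :
    ∫ z, φ z.2 ∂((μ.prod π).tilted fun z => u * φ z.2) = ∫ c, φ c ∂(π.tilted fun c => u * φ c) := by
  rw [integral_tilted_eq_div, integral_tilted_eq_div]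
  have e1 := integral_prod_mul (μ := μ) (ν := π) (fun _ : α => (1 : ℝ)) (fun c => φ c * Real.exp (u * φ c))
  have e2 := integral_prod_mul (μ := μ) (ν := π) (fun _ : α => (1 : ℝ)) (fun c => Real.exp (u * φ c))
  simp only [one_mul] at e1 e2
  rw [e1, e2, integral_const, smul_eq_mul, mul_one]
  have hμ : μ.real Set.univ ≠ 0 := (measureReal_univ_pos (μ := μ)).ne'
  rw [mul_div_mul_left _ _ hμ]

/-- ★ **THE CONDITIONED OSCILLATION VANISHES.**  Under the interpolating fine law `ν̂_u = (μ ⊗ π).tilted (u·(φ∘snd))` the conditioned direction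
`h_u ∘ fst` equals the fine drift almost surely, so `∫ |h_u(z.1) − ∫ φ∘snd dν̂_u| dν̂_u(z) = 0` — the junction's OSC letter with `ρ = 0`, although
the raw oscillation `∫ |φ(z.2) − c_u| dν̂_u` is whatever `φ` makes it. [folklore] -/
theorem condOsc_prod_eq_zero [NeZero μ] (hφm : Measurable φ) (u : ℝ) :
    ∫ z, |(∫ w, φ w.2 ∂((condLaw (μ.prod π) Prod.fst z.1).tilted fun w => u * φ w.2)) -
        ∫ y, φ y.2 ∂((μ.prod π).tilted fun y => u * φ y.2)| ∂((μ.prod π).tilted fun y => u * φ y.2) = 0 := by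
  rw [integral_dir_prod_tilted μ π u]
  refine integral_eq_zero_of_ae ?_
  -- `μ`-a.e. in the class coordinate ⇒ `(μ ⊗ π)`-a.e. ⇒ `ν̂_u`-a.e.
  have h1 : ∀ᵐ z ∂(μ.prod π), (∫ w, φ w.2 ∂((condLaw (μ.prod π) Prod.fst z.1).tilted fun w => u * φ w.2)) =
      ∫ c, φ c ∂(π.tilted fun c => u * φ c) :=
    (Measure.quasiMeasurePreserving_fst (μ := μ) (ν := π)).ae (condDirection_prod_ae μ π hφm u)
  have h2 := (tilted_absolutelyContinuous (μ.prod π) fun y => u * φ y.2).ae_le h1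
  filter_upwards [h2] with z hz
  simp [hz]

end Letters

/-! ## §3 The junction instantiated: the fibre defect is invisible on the class space -/

section Toy

variable [StandardBorelSpace α] [StandardBorelSpace γ] [Nonempty α] [Nonempty γ]
  (μ : Measure α) [IsFiniteMeasure μ] (π : Measure γ) [IsProbabilityMeasure π] {φ : γ → ℝ} {B : ℝ}

/-- ★★ **`tvSandwich_of_finePath` INHABITED (referee A1∕A2 — every datum PRODUCED).**  One class (`ι = Unit`, `T K = {()}`, no bad class), fine pieces
`νA = μ ⊗ π`, `νB = e^{φ∘snd}·(μ ⊗ π)`, straight path `Ψ_u = u·(φ∘snd)` (its regularity letters are the toy's arithmetic), fine DRIFT irrelevant here,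
CONDITIONED OSC `= 0` (`condOsc_prod_eq_zero`) ⇒ with `ρ ≡ 0`: the normalised IMAGE laws of the two runs agree on every measurable class-space set,
at every `t` of any window — for EVERY bounded measurable `φ`. [folklore] -/
theorem tvSandwich_toy (hφm : Measurable φ) (hφb : ∀ c, |φ c| ≤ B) (l₀ : ℝ) :
    ∀ (K : ℕ) (t : ℝ), |t| ≤ l₀ → ∀ τ ∈ (Finset.univ : Finset Unit) \ (∅ : Finset Unit), ∀ S : Set α, MeasurableSet S →
      |(((μ.prod π).withDensity fun z => ENNReal.ofReal (Real.exp (1 * φ z.2))).map Prod.fst).real S /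
          (((μ.prod π).withDensity fun z => ENNReal.ofReal (Real.exp (1 * φ z.2))).map Prod.fst).real Set.univ -
        ((μ.prod π).map Prod.fst).real S / ((μ.prod π).map Prod.fst).real Set.univ| ≤ 0 := by
  have hB0 : 0 ≤ B := (abs_nonneg _).trans (hφb (Classical.arbitrary γ))
  refine tvSandwich_of_finePath (ι := Unit) (Φ := fun _ => α × γ) (Ω := fun _ => α) (q := fun _ => Prod.fst)
    (νA := fun _ _ => μ.prod π) (νB := fun _ _ => (μ.prod π).withDensity fun z => ENNReal.ofReal (Real.exp (1 * φ z.2)))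
    (T := fun _ => Finset.univ) (Bad := fun _ _ => ∅) (ρ := fun _ => 0)
    (Ψ := fun _ _ u z => u * φ z.2) (Ψ' := fun _ _ _ z => φ z.2)
    (Λ := fun _ _ u a => Real.log (∫ z, Real.exp (u * φ z.2) ∂(condLaw (μ.prod π) Prod.fst a)))
    (h := fun _ _ u a => ∫ z, φ z.2 ∂((condLaw (μ.prod π) Prod.fst a).tilted fun z => u * φ z.2))
    (fun _ => measurable_fst) (fun _ _ u => measurable_const.mul (hφm.comp measurable_snd)) (fun _ _ _ => hφm.comp measurable_snd)
    (fun _ _ u z => by simpa using (hasDerivAt_id u).mul_const (φ z.2)) (fun _ _ u₀ => ?_) (fun _ _ z => by simp)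
    (fun _ _ _ => rfl) (fun _ => le_rfl) (fun _ _ _ _ => rfl) (fun _ _ _ _ => rfl) (fun K t ht τ hτ h0 u hu => ?_)
  · -- local uniform bounds on the ball of radius 1: `M = (|u₀| + 1)·B`
    refine ⟨1, one_pos, (|u₀| + 1) * B, fun u hu z => ⟨?_, ?_⟩⟩
    · have hu' : |u| ≤ |u₀| + 1 := by
        have := Metric.mem_ball.1 hu
        rw [Real.dist_eq] at this
        linarith [abs_sub_abs_le_abs_sub u u₀]
      rw [abs_mul]
      exact mul_le_mul hu' (hφb z.2) (abs_nonneg _) (by positivity)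
    · calc |φ z.2| ≤ B := hφb z.2
        _ = 1 * B := (one_mul B).symm
        _ ≤ (|u₀| + 1) * B := mul_le_mul_of_nonneg_right (by linarith [abs_nonneg u₀]) hB0
  · -- the conditioned oscillation vanishes
    haveI : NeZero μ := ⟨fun hμ => h0 (by simp [hμ])⟩
    show ∫ z, |(∫ w, φ w.2 ∂((condLaw (μ.prod π) Prod.fst z.1).tilted fun w => u * φ w.2)) -
        ∫ y, φ y.2 ∂((μ.prod π).tilted fun y => u * φ y.2)| ∂((μ.prod π).tilted fun y => u * φ y.2) ≤ 2 * 0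
    rw [condOsc_prod_eq_zero μ π hφm u]
    simp

/-- ★★ **`core_of_finePath` INHABITED — A FIBRE-ONLY DEFECT COSTS NOTHING AT THE CLASS LEVEL.**  Same toy; dressed class terms = the MGFs of ONE
`B`-bounded class observable `w` under the two IMAGE laws (MGF form by `rfl`); class-free drift `k(u) = log ∫ e^{u·φ} dπ` (the fibre log-MGF, its
derivative the fine drift EXACTLY — `r₁ ≡ 0`, module I's `hasDerivAt_log_integral_exp_tiltPath` on `π`); conditioned oscillation `0` (`ρ ≡ 0`); width
budget `0 ≤ vol·0`.  Conclusion: `Spine.NE7.Core l₀ vol T Bad P Q 0` — the two runs' dressed class terms are sandwiched with ONE constant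
(`c = log ∫ e^{φ} dπ`, the mass shift) and width ZERO, at every `t`, for every bounded `w` and every bounded `φ`. [folklore] -/
theorem core_toy (hφm : Measurable φ) (hφb : ∀ c, |φ c| ≤ B) {w : α → ℝ} {Bw : ℝ} (hwm : Measurable w) (hwb : ∀ a, |w a| ≤ Bw)
    (l₀ vol : ℝ) :
    Spine.NE7.Core l₀ vol (fun _ : ℕ => (Finset.univ : Finset Unit)) (fun _ _ => (∅ : Finset Unit))
      (fun _ t _ => mgf w ((μ.prod π).map Prod.fst) t)
      (fun _ t _ => mgf w (((μ.prod π).withDensity fun z => ENNReal.ofReal (Real.exp (1 * φ z.2))).map Prod.fst) t)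
      (fun _ => 0) := by
  have hB0 : 0 ≤ B := (abs_nonneg _).trans (hφb (Classical.arbitrary γ))
  have hBw0 : 0 ≤ Bw := (abs_nonneg _).trans (hwb (Classical.arbitrary α))
  -- MGF form on the image laws, by `rfl`
  have hP : MGFForm Bw (fun _ : ℕ => (Finset.univ : Finset Unit)) (fun _ : ℕ => w)
      (fun (_ : ℕ) (_ : Unit) => (μ.prod π).map Prod.fst) (fun _ t _ => mgf w ((μ.prod π).map Prod.fst) t) :=
    ⟨hBw0, fun _ => hwm, fun _ => hwb, fun _ _ _ => by infer_instance, fun _ _ _ _ => rfl⟩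
  have hexp1 : Integrable (fun z : α × γ => Real.exp (1 * φ z.2)) (μ.prod π) :=
    integrable_exp_of_abs_le (μ := μ.prod π) (measurable_const.mul (hφm.comp measurable_snd)) (R := (|(1:ℝ)| + 0) * B + B)
      fun z => by rw [abs_mul]; nlinarith [hφb z.2, abs_nonneg (φ z.2), abs_nonneg (1:ℝ)]
  have hQ : MGFForm Bw (fun _ : ℕ => (Finset.univ : Finset Unit)) (fun _ : ℕ => w)
      (fun (_ : ℕ) (_ : Unit) => ((μ.prod π).withDensity fun z => ENNReal.ofReal (Real.exp (1 * φ z.2))).map Prod.fst)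
      (fun _ t _ => mgf w (((μ.prod π).withDensity fun z => ENNReal.ofReal (Real.exp (1 * φ z.2))).map Prod.fst) t) :=
    ⟨hBw0, fun _ => hwm, fun _ => hwb, fun _ _ _ => by
      haveI : IsFiniteMeasure ((μ.prod π).withDensity fun z => ENNReal.ofReal (Real.exp (1 * φ z.2))) :=
        isFiniteMeasure_withDensity_ofReal hexp1.2
      infer_instance, fun _ _ _ _ => rfl⟩
  refine core_of_finePath (ι := Unit) (Φ := fun _ => α × γ) (Ω := fun _ => α) (q := fun _ => Prod.fst)
    (νA := fun _ _ => μ.prod π) (νB := fun _ _ => (μ.prod π).withDensity fun z => ENNReal.ofReal (Real.exp (1 * φ z.2)))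
    (T := fun _ => Finset.univ) (Bad := fun _ _ => ∅) (ρ := fun _ => 0) (r₁ := fun _ => 0)
    (Ψ := fun _ _ u z => u * φ z.2) (Ψ' := fun _ _ _ z => φ z.2)
    (Λ := fun _ _ u a => Real.log (∫ z, Real.exp (u * φ z.2) ∂(condLaw (μ.prod π) Prod.fst a)))
    (h := fun _ _ u a => ∫ z, φ z.2 ∂((condLaw (μ.prod π) Prod.fst a).tilted fun z => u * φ z.2))
    (k := fun _ u => Real.log (∫ c, Real.exp (u * φ c) ∂π)) (k' := fun _ u => ∫ c, φ c ∂(π.tilted fun c => u * φ c))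
    (fun _ => measurable_fst) hP hQ (fun _ _ u => measurable_const.mul (hφm.comp measurable_snd)) (fun _ _ _ => hφm.comp measurable_snd)
    (fun _ _ u z => by simpa using (hasDerivAt_id u).mul_const (φ z.2)) (fun _ _ u₀ => ?_) (fun _ _ z => by simp)
    (fun _ _ _ => rfl) (fun _ => le_rfl) (fun _ _ _ _ => rfl) (fun _ _ _ _ => rfl) (fun _ u _ => ?_)
    (fun K t ht τ hτ h0 u hu => ?_) (fun K t ht τ hτ h0 u hu => ?_) (fun _ => by simp)
  · -- local uniform bounds on the ball of radius 1: `M = (|u₀| + 1)·B`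
    refine ⟨1, one_pos, (|u₀| + 1) * B, fun u hu z => ⟨?_, ?_⟩⟩
    · have hu' : |u| ≤ |u₀| + 1 := by
        have := Metric.mem_ball.1 hu
        rw [Real.dist_eq] at this
        linarith [abs_sub_abs_le_abs_sub u u₀]
      rw [abs_mul]
      exact mul_le_mul hu' (hφb z.2) (abs_nonneg _) (by positivity)
    · calc |φ z.2| ≤ B := hφb z.2
        _ = 1 * B := (one_mul B).symm
        _ ≤ (|u₀| + 1) * B := mul_le_mul_of_nonneg_right (by linarith [abs_nonneg u₀]) hB0
  · -- the class-free drift `k(u) = log ∫ e^{uφ} dπ` has derivative the fine drift (module I on `π`)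
    refine (hasDerivAt_log_integral_exp_tiltPath (μ := π) (ψ := fun v c => v * φ c) (ψ' := fun _ c => φ c)
      (fun v => measurable_const.mul hφm) (fun _ => hφm) (fun v c => by simpa using (hasDerivAt_id v).mul_const (φ c))
      ⟨1, one_pos, (|u| + 1) * B, fun v hv c => ⟨?_, ?_⟩⟩).hasDerivWithinAt
    · have hv' : |v| ≤ |u| + 1 := by
        have := Metric.mem_ball.1 hv
        rw [Real.dist_eq] at this
        linarith [abs_sub_abs_le_abs_sub v u]
      rw [abs_mul]
      exact mul_le_mul hv' (hφb c) (abs_nonneg _) (by positivity)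
    · calc |φ c| ≤ B := hφb c
        _ = 1 * B := (one_mul B).symm
        _ ≤ (|u| + 1) * B := mul_le_mul_of_nonneg_right (by linarith [abs_nonneg u]) hB0
  · -- the fine drift IS `k′(u)`: residual `r₁ = 0`
    haveI : NeZero μ := ⟨fun hμ => h0 (by simp [hμ])⟩
    show |∫ z, φ z.2 ∂((μ.prod π).tilted fun z => u * φ z.2) - ∫ c, φ c ∂(π.tilted fun c => u * φ c)| ≤ 0
    rw [integral_dir_prod_tilted μ π u, sub_self, abs_zero]
  · -- the conditioned oscillation vanishes
    haveI : NeZero μ := ⟨fun hμ => h0 (by simp [hμ])⟩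
    show ∫ z, |(∫ w', φ w'.2 ∂((condLaw (μ.prod π) Prod.fst z.1).tilted fun w' => u * φ w'.2)) -
        ∫ y, φ y.2 ∂((μ.prod π).tilted fun y => u * φ y.2)| ∂((μ.prod π).tilted fun y => u * φ y.2) ≤ 2 * 0
    rw [condOsc_prod_eq_zero μ π hφm u]
    simp

/-- ★ **THE SAME SENTENCE WITHOUT THE FAMILY APPARATUS**: the image of the fibre-tilted product law IS the normalised image law —
`((μ ⊗ π).tilted (φ∘snd)).map fst = (μ ⊗ π).map fst` up to normalisation, i.e. `= (μ.real univ)⁻¹ • μ`… stated as equality of the two tilts of the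
image law: `((μ ⊗ π).tilted (φ∘snd)).map fst = ((μ ⊗ π).map fst).tilted 0` (K12a′ with `Λ` constant a.e.). [folklore] -/
theorem map_tilted_fibreDefect_eq (hφm : Measurable φ) (hφb : ∀ c, |φ c| ≤ B) :
    ((μ.prod π).tilted fun z => φ z.2).map Prod.fst = ((μ.prod π).map Prod.fst).tilted fun _ => (0 : ℝ) := by
  have hψm : Measurable fun z : α × γ => φ z.2 := hφm.comp measurable_snd
  have hψb : ∀ z : α × γ, |φ z.2| ≤ B := fun z => hφb z.2
  rw [map_tilted_eq_tilted_fibreLogMGF (μ.prod π) measurable_fst hψm hψb (Λ := fun a =>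
    Real.log (∫ z, Real.exp (φ z.2) ∂(condLaw (μ.prod π) Prod.fst a))) (fun _ => rfl)]
  -- `Λ` is the constant `log ∫ e^φ dπ` almost everywhere on the image law; tilting by an a.e.-constant is tilting by `0`
  have hΛ : (fun a => Real.log (∫ z, Real.exp (φ z.2) ∂(condLaw (μ.prod π) Prod.fst a))) =ᵐ[(μ.prod π).map Prod.fst]
      fun _ => Real.log (∫ c, Real.exp (φ c) ∂π) := by
    rw [Measure.map_fst_prod, measure_univ, one_smul]
    filter_upwards [condLaw_prod_fst_ae μ π] with a ha
    rw [ha, integral_dirac_prod_comp_snd a π (f := fun c => Real.exp (φ c)) (Real.measurable_exp.comp hφm)]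
  rw [tilted_congr hΛ, tilted_const', tilted_const']

end Toy

end YMDAG.N14.LawChannelPushForwardToy

end
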